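import Literature.NumberTheory.EllipticCurves.PadicTwoSupportOfColemanTrace
import HarnessLib

/-!
# The moments socket read back in `𝐃 = 𝒪̂_{F^nr}`-currency: `D = (1+S)d/dS` commutes with coefficient maps,
# so `[S^0] D^k (θ(h₀ ∘ ϑ)) = θ(ι([S^0] D^k (h₀ ∘ ϑ)))`, and at `F = ℚ₂` this is `J([S^0] D^k (h₀ ∘ ϑ))`

Topic `NumberTheory/EllipticCurves`; namespace `Literature.NumberTheory.EllipticCurves`
(`§3` in `Literature.NumberTheory.EllipticCurves.PadicTwo`).

De Shalit, *Iwasawa theory of elliptic curves with complex multiplication* (1987), I.3.5 (11) (p. 18):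
`∫ κ^k dμ_β = D^k log g_β (0) =: δ_k(β)`, `D = (1+S) d/dS`; the right-hand side is an element of
`𝐃 = 𝒪̂_{F^nr}` (I.3.4), read in `ℂ_p` only to be compared with the integral.  The socket
`integral_restrictUnits_density_unitInv_pow_succ_of_colemanTrace_eq_zero`
(`PAdicOneVariableSupportOfColemanTraceTwo.lean`, and its `F := ℚ_[2]` discharge in
`PadicTwoSupportOfColemanTrace.lean`) states (11) with right-hand side
`[S^0] D^k H'` for the `ℂ_2`-valued series `H' = θ(h₀ ∘ ϑ)`, where `h₀ ∘ ϑ` is formed AFTER pushing the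
coefficients of `h₀ ∈ 𝒪[F]⟦X⟧` and `ϑ ∈ 𝐃⟦X⟧` into `𝒪_{ℂ_F}`.  This file reads that right-hand side back in
`𝐃`: it is the image of `δ_k := [S^0] D^k (h₀ ∘ ϑ) ∈ 𝐃` (composition performed in `𝐃⟦X⟧`) under
`θ ∘ ι : 𝐃 → 𝒪_{ℂ_F} → ℂ_2`, and at `F = ℚ₂`, `θ` the canonical `ℂ_{ℚ₂} ≃ ℂ_[2]`, under the direct lift
`J = maxUnramifiedCompletion.toPadicComplex 2 : 𝐃 → ℂ_[2]` (`θ ∘ ι = J`,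
`CompletedAlgClosure.equivPadicComplex_toC`).

* §1 (any commutative rings) `mahlerD_map : D(P.map f) = (DP).map f`, `mahlerD_iterate_map`,
  `coeff_mahlerD_iterate_map`, ★ `constantCoeff_mahlerD_iterate_map : [S^0] D^k (P.map f) = f ([S^0] D^k P)`,
  `map_subst_map_map : (h.map (f ∘ e)).subst (φ.map f) = ((h.map e).subst φ).map f`,
  `constantCoeff_mahlerD_iterate_subst_map`;
* §2 (generic `F`, `θ : ℂ_F → ℂ_[2]`) `subst_map_compSeriesC_eq_map`: the socket's series IS `(h₀ ∘ ϑ).map ι`;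
  ★ `constantCoeff_mahlerD_iterate_map_theta : [S^0] D^k H' = θ (toC ([S^0] D^k (h₀ ∘ ϑ)))`;
  ★★ `integral_restrictUnits_density_unitInv_pow_succ_eq_theta_toC_of_colemanTrace_eq_zero` — the socket with
  its right-hand side in `𝐃`-currency;
* §3 (`F := ℚ_[2]`, `θ := CompletedAlgClosure.equivPadicComplex 2`)
  ★ `PadicTwo.constantCoeff_mahlerD_iterate_eq_toPadicComplex : [S^0] D^k H' = J ([S^0] D^k (h₀ ∘ ϑ))`,
  `PadicTwo.map_theta_eq_map_toPadicComplex : H' = (h₀ ∘ ϑ).map J`,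
  ★★ `PadicTwo.integral_restrictUnits_density_unitInv_pow_succ_eq_toPadicComplex_of_colemanTrace_eq_zero` (RHS
  in `𝐃`-currency) and ★★ `PadicTwo.integral_restrictUnits_density_pow_succ_map_toPadicComplex_of_colemanTrace_eq_zero`
  (BOTH sides in `𝐃`-currency: the distribution is `D_{(h₀∘ϑ).map J}`).

Everything is proved; no named facts, no definitions, no instances, no `sorry`.

## References

* [deShalit1987] E. de Shalit, *Iwasawa theory of elliptic curves with complex multiplication* (1987),
  I.3.4 (p. 18), I.3.5 (11) (p. 18), I.3.3 (7)–(8) (p. 17).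
* [FontaineOuyang2022] J.-M. Fontaine, Y. Ouyang, *Theory of `p`-adic Galois representations*, §3.1.
-/

noncomputable section

open MvPowerSeries Filter
open scoped PowerSeries.WithPiTopology Topology

namespace Literature.NumberTheory.EllipticCurves

/-! ### §1. `D = (1+S) d/dS` commutes with coefficient maps -/

section Algebra

variable {R S T : Type*} [CommRing R] [CommRing S] [CommRing T] (f : R →+* S)

/-- Bridge between the two spellings of the coefficient map on one-variable series: a term
`PowerSeries.subst φ h` is displayed at type `MvPowerSeries Unit R`, so dot-notation `.map` on it elaborates to
`MvPowerSeries.map`; the two maps agree by definition. [folklore] -/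
private theorem mvPowerSeries_map_eq_map (P : PowerSeries R) : MvPowerSeries.map (σ := Unit) f P = PowerSeries.map f P :=
  rfl

/-- **`D` commutes with coefficient maps**: `D (P.map f) = (D P).map f` for `D = (1+S)d/dS` and any ring map
`f` (the coefficients of `DP` are `ℤ`-linear in those of `P`). [cite: deShalit1987, I.3.5 (p. 18)] -/
theorem mahlerD_map (P : PowerSeries R) : mahlerD (P.map f) = (mahlerD P).map f := by
  ext n
  simp only [coeff_mahlerD, PowerSeries.coeff_map, map_add, map_mul, map_natCast, map_one]

/-- `D^k` commutes with coefficient maps. [cite: deShalit1987, I.3.5 (p. 18)] -/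
theorem mahlerD_iterate_map (P : PowerSeries R) (k : ℕ) :
    mahlerD^[k] (P.map f) = (mahlerD^[k] P).map f := by
  induction k generalizing P with
  | zero => rfl
  | succ k ih => rw [Function.iterate_succ_apply, Function.iterate_succ_apply, mahlerD_map, ih]

/-- The coefficients of `D^k (P.map f)` are the `f`-images of those of `D^k P`.
[cite: deShalit1987, I.3.5 (p. 18)] -/
theorem coeff_mahlerD_iterate_map (P : PowerSeries R) (k n : ℕ) :
    PowerSeries.coeff n (mahlerD^[k] (P.map f)) = f (PowerSeries.coeff n (mahlerD^[k] P)) := by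
  rw [mahlerD_iterate_map, PowerSeries.coeff_map]

/-- ★ **`[S^0] D^k (P.map f) = f ([S^0] D^k P)`** — the `k`-th moment value read through a coefficient map.
[cite: deShalit1987, I.3.5 (11) (p. 18)] -/
theorem constantCoeff_mahlerD_iterate_map (P : PowerSeries R) (k : ℕ) :
    PowerSeries.constantCoeff (mahlerD^[k] (P.map f)) = f (PowerSeries.constantCoeff (mahlerD^[k] P)) := by
  rw [← PowerSeries.coeff_zero_eq_constantCoeff_apply, coeff_mahlerD_iterate_map,
    PowerSeries.coeff_zero_eq_constantCoeff_apply]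

/-- **Composition before or after a coefficient map**: for `φ ∈ R⟦X⟧` substitutable (`φ(0)` nilpotent),
`e : T → R` and `f : R → S`, `(h.map (f ∘ e)) ∘ (φ.map f) = ((h.map e) ∘ φ).map f` — Mathlib's
`PowerSeries.map_subst` in the shape the comparison files use (`h = h₀ ∈ 𝒪[F]⟦X⟧`, `e : 𝒪[F] → 𝐃`,
`f = ι : 𝐃 → 𝒪_{ℂ_F}`, `φ = ϑ`). [cite: deShalit1987, I.3.3 (8) (p. 17)] -/
theorem map_subst_map_map {φ : PowerSeries R} (hφ : PowerSeries.HasSubst φ) (e : T →+* R) (h : PowerSeries T) :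
    (h.map (f.comp e)).subst (φ.map f) = ((h.map e).subst φ).map f := by
  rw [PowerSeries.map_comp, RingHom.comp_apply]
  exact (PowerSeries.map_subst hφ (h := f) (h.map e)).symm

/-- ★ `[S^0] D^k ((h.map (f ∘ e)) ∘ (φ.map f)) = f ([S^0] D^k ((h.map e) ∘ φ))`.
[cite: deShalit1987, I.3.5 (11) (p. 18)] -/
theorem constantCoeff_mahlerD_iterate_subst_map {φ : PowerSeries R} (hφ : PowerSeries.HasSubst φ) (e : T →+* R)
    (h : PowerSeries T) (k : ℕ) :
    PowerSeries.constantCoeff (mahlerD^[k] ((h.map (f.comp e)).subst (φ.map f))) =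
      f (PowerSeries.constantCoeff (mahlerD^[k] ((h.map e).subst φ))) := by
  rw [map_subst_map_map f hφ e h, mvPowerSeries_map_eq_map, constantCoeff_mahlerD_iterate_map]

/-- Transport of the inverse Amice transform along an equality of series (the bound proof is irrelevant).
[cite: deShalit1987, I.3.3 (8) (p. 17)] -/
theorem invAmice₁_congr {p : ℕ} [Fact p.Prime] {𝕜 : Type*} [NormedField 𝕜] [NormedAlgebra ℚ_[p] 𝕜]
    [IsUltrametricDist 𝕜] [CompleteSpace 𝕜] {C : ℝ} {P P' : PowerSeries 𝕜} (hPP' : P = P')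
    (hC : ∀ k, ‖PowerSeries.coeff k P‖ ≤ C) (hC' : ∀ k, ‖PowerSeries.coeff k P'‖ ≤ C) :
    invAmice₁ p P hC = invAmice₁ p P' hC' := by
  subst hPP'
  rfl

end Algebra

/-! ### §2. The socket's right-hand side in `𝐃`-currency (generic `F`, `θ`) -/

section Unramified

open ValuativeRel IsLocalRing Field
open Literature.NumberTheory.GaloisRepresentations Literature.NumberTheory.GaloisRepresentations.IsNonarchimedeanLocalField
  Literature.NumberTheory.GaloisRepresentations.LubinTate Literature.NumberTheory.PAdicHodge

variable {F : Type} [Field F] [ValuativeRel F] [TopologicalSpace F] [IsNonarchimedeanLocalField F]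

attribute [local instance] ltNormUniformSpace ltNormIsUniformAddGroup rk1 nF nE fintypeResidueField

variable {π : 𝒪[F]} (hπ : (valuation F).IsUniformizer (π : F))
  (hq : residueFieldCard F = 2) (h2 : (valuation F).IsUniformizer (((2 : ℕ) : 𝒪[F]) : F))
  {σ₀ : absoluteGaloisGroup F} (hσ₀ : IsAbsArithFrob σ₀) (u : 𝒪[F]ˣ)
  {ε : (maxUnramifiedCompletion F)ˣ}
  (hε : maxUnramifiedCompletion.galAut F σ₀ (ε : maxUnramifiedCompletion F) =
    algebraMap 𝒪[F] (maxUnramifiedCompletion F) (u : 𝒪[F]) * (ε : maxUnramifiedCompletion F))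
variable (θ : CompletedAlgClosure F →+* ℂ_[2]) (hθc : Continuous θ)
  (hθ1 : ∀ z : CBall F, ‖θ (z : CompletedAlgClosure F)‖ ≤ 1)
  (hθζ : ∀ ζ' : ℂ_[2], (∃ n : ℕ, ζ' ^ 2 ^ n = 1) →
    ∃ ζ : CompletedAlgClosure F, (∃ n : ℕ, ζ ^ 2 ^ n = 1) ∧ θ ζ = ζ')

/-- `ϑ ∈ 𝐃⟦X⟧` is substitutable (`ϑ(0) = 0`). [cite: LubinTate1965, Lemma p. 385] -/
theorem hasSubst_compSeriesC : PowerSeries.HasSubst (compSeriesC hπ hσ₀ u hε) :=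
  PowerSeries.HasSubst.of_constantCoeff_zero' (constantCoeff_compSeriesC hπ hσ₀ u hε)

/-- **The socket's series is `(h₀ ∘ ϑ).map ι`**: composing `h₀` with `ϑ` over `𝐃 = 𝒪̂_{F^nr}` and THEN
pushing the coefficients to `𝒪_{ℂ_F}` gives the series the support/socket files form over `𝒪_{ℂ_F}`
(`e : 𝒪[F] → 𝐃` the structure map on the discrete copies, `ι : 𝐃 → 𝒪_{ℂ_F}`).
[cite: deShalit1987, I.3.3 (8) (p. 17)] -/
theorem subst_map_compSeriesC_eq_map (h₀ : PowerSeries (LTCoeff F)) :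
    PowerSeries.subst ((compSeriesC hπ hσ₀ u hε).map (algebraMap (UnrCoeff F) (CBall F)))
        (h₀.map ((algebraMap (UnrCoeff F) (CBall F)).comp
          ((intToUnrCoeff F).comp (LTCoeff.of F).symm.toRingHom))) =
      ((h₀.map ((intToUnrCoeff F).comp (LTCoeff.of F).symm.toRingHom)).subst
        (compSeriesC hπ hσ₀ u hε)).map (algebraMap (UnrCoeff F) (CBall F)) :=
  map_subst_map_map (algebraMap (UnrCoeff F) (CBall F)) (hasSubst_compSeriesC hπ hσ₀ u hε) _ h₀

/-- ★ **`[S^0] D^k θ(h₀ ∘ ϑ) = θ (ι ([S^0] D^k (h₀ ∘ ϑ)))`** with `h₀ ∘ ϑ ∈ 𝐃⟦X⟧` and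
`ι = maxUnramifiedCompletion.toC F : 𝐃 → ℂ_F`: the right-hand side of the socket is the image of de Shalit's
`δ_k ∈ 𝐃`. [cite: deShalit1987, I.3.5 (11) (p. 18), I.3.4 (p. 18)] -/
theorem constantCoeff_mahlerD_iterate_map_theta (h₀ : PowerSeries (LTCoeff F)) (k : ℕ) :
    PowerSeries.constantCoeff (mahlerD^[k]
        ((PowerSeries.subst ((compSeriesC hπ hσ₀ u hε).map (algebraMap (UnrCoeff F) (CBall F)))
          (h₀.map ((algebraMap (UnrCoeff F) (CBall F)).comp
            ((intToUnrCoeff F).comp (LTCoeff.of F).symm.toRingHom)))).map (θ.comp (CBall F).subtype))) =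
      θ (maxUnramifiedCompletion.toC F ((UnrCoeff.of F).symm
        (PowerSeries.constantCoeff (mahlerD^[k]
          ((h₀.map ((intToUnrCoeff F).comp (LTCoeff.of F).symm.toRingHom)).subst
            (compSeriesC hπ hσ₀ u hε)))))) := by
  rw [mvPowerSeries_map_eq_map, constantCoeff_mahlerD_iterate_map, subst_map_compSeriesC_eq_map,
    mvPowerSeries_map_eq_map, constantCoeff_mahlerD_iterate_map, RingHom.comp_apply, Subring.subtype_apply,
    algebraMap_unrCoeff_coe]

include hq hθc hθζ in
/-- ★★ **THE SOCKET WITH ITS RIGHT-HAND SIDE IN `𝐃`-CURRENCY** (generic `F`, `θ`): for `h₀ ∈ 𝒪[F]⟦X⟧` with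
`𝒮_{f'} h₀ = 0` (`f' = π'X + X²`, `π' = 2u`) and every `k`,
`∫ x^{k+1} d(restrictUnits (x⁻¹ · D_{θ(h₀∘ϑ)})) = θ (ι (δ_k))`, `δ_k := [S^0] D^k (h₀ ∘ ϑ) ∈ 𝐃`.
[cite: deShalit1987, I.3.5 (11) (p. 18), I.3.3 (7)–(8) (p. 17)] -/
theorem integral_restrictUnits_density_unitInv_pow_succ_eq_theta_toC_of_colemanTrace_eq_zero (n : ℕ)
    (h₀ : PowerSeries (LTCoeff F)) (hS : colemanTrace (isUniformizer_unit_mul h2 u) n h₀ = 0) (k : ℕ) :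
    (restrictUnits ((invAmice₁ 2
        ((PowerSeries.subst ((compSeriesC h2 hσ₀ u hε).map (algebraMap (UnrCoeff F) (CBall F)))
          (h₀.map ((algebraMap (UnrCoeff F) (CBall F)).comp
            ((intToUnrCoeff F).comp (LTCoeff.of F).symm.toRingHom)))).map (θ.comp (CBall F).subtype))
        (norm_coeff_map_le_one θ hθ1
          (PowerSeries.subst ((compSeriesC h2 hσ₀ u hε).map (algebraMap (UnrCoeff F) (CBall F)))
            (h₀.map ((algebraMap (UnrCoeff F) (CBall F)).comp
              ((intToUnrCoeff F).comp (LTCoeff.of F).symm.toRingHom)))))).density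
        (ProfiniteTower.padicInt_isUniform 2) (unitInv ℂ_[2]) uniformContinuous_unitInv norm_unitInv_le)).integral
        (fun x ↦ padicIntCast ℂ_[2] (x ^ (k + 1))) =
      θ (maxUnramifiedCompletion.toC F ((UnrCoeff.of F).symm
        (PowerSeries.constantCoeff (mahlerD^[k]
          ((h₀.map ((intToUnrCoeff F).comp (LTCoeff.of F).symm.toRingHom)).subst
            (compSeriesC h2 hσ₀ u hε)))))) := by
  rw [integral_restrictUnits_density_unitInv_pow_succ_of_colemanTrace_eq_zero hq h2 hσ₀ u hε θ hθc hθ1 hθζ n h₀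
    hS k, constantCoeff_mahlerD_iterate_map_theta]

end Unramified

/-! ### §3. `F = ℚ₂`, `θ = CompletedAlgClosure.equivPadicComplex 2`: the right-hand side is `J(δ_k)` -/

namespace PadicTwo

open ValuativeRel IsLocalRing Field
open Literature.NumberTheory.GaloisRepresentations Literature.NumberTheory.GaloisRepresentations.IsNonarchimedeanLocalField
  Literature.NumberTheory.GaloisRepresentations.LubinTate Literature.NumberTheory.PAdicHodge

attribute [local instance] ltNormUniformSpace ltNormIsUniformAddGroup rk1 nF nE fintypeResidueField

/-- ★ **`F = ℚ₂`: `[S^0] D^k θ(h₀ ∘ ϑ) = J ([S^0] D^k (h₀ ∘ ϑ))`** with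
`J = maxUnramifiedCompletion.toPadicComplex 2 : 𝐃 → ℂ_[2]` (`θ ∘ ι = J`).
[cite: deShalit1987, I.3.5 (11) (p. 18), I.3.4 (p. 18)] [cite: FontaineOuyang2022, §3.1] -/
theorem constantCoeff_mahlerD_iterate_eq_toPadicComplex :
    haveI := Padic.isNonarchimedeanLocalField_holds 2
    ∀ {π : 𝒪[ℚ_[2]]} (hπ : (valuation ℚ_[2]).IsUniformizer (π : ℚ_[2]))
      {σ₀ : absoluteGaloisGroup ℚ_[2]} (hσ₀ : IsAbsArithFrob σ₀) (u : 𝒪[ℚ_[2]]ˣ)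
      {ε : (maxUnramifiedCompletion ℚ_[2])ˣ}
      (hε : maxUnramifiedCompletion.galAut ℚ_[2] σ₀ (ε : maxUnramifiedCompletion ℚ_[2]) =
        algebraMap 𝒪[ℚ_[2]] (maxUnramifiedCompletion ℚ_[2]) (u : 𝒪[ℚ_[2]]) * (ε : maxUnramifiedCompletion ℚ_[2]))
      (h₀ : PowerSeries (LTCoeff ℚ_[2])) (k : ℕ),
      PowerSeries.constantCoeff (mahlerD^[k]
        ((PowerSeries.subst ((compSeriesC hπ hσ₀ u hε).map (algebraMap (UnrCoeff ℚ_[2]) (CBall ℚ_[2])))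
          (h₀.map ((algebraMap (UnrCoeff ℚ_[2]) (CBall ℚ_[2])).comp
            ((intToUnrCoeff ℚ_[2]).comp (LTCoeff.of ℚ_[2]).symm.toRingHom)))).map
          ((CompletedAlgClosure.equivPadicComplex 2).toRingHom.comp (CBall ℚ_[2]).subtype))) =
      maxUnramifiedCompletion.toPadicComplex 2 ((UnrCoeff.of ℚ_[2]).symm
        (PowerSeries.constantCoeff (mahlerD^[k]
          ((h₀.map ((intToUnrCoeff ℚ_[2]).comp (LTCoeff.of ℚ_[2]).symm.toRingHom)).subst
            (compSeriesC hπ hσ₀ u hε))))) := by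
  haveI := Padic.isNonarchimedeanLocalField_holds 2
  intro π hπ σ₀ hσ₀ u ε hε h₀ k
  rw [constantCoeff_mahlerD_iterate_map_theta, RingEquiv.toRingHom_eq_coe, RingHom.coe_coe,
    CompletedAlgClosure.equivPadicComplex_toC]

/-- **`F = ℚ₂`: the socket's series is `(h₀ ∘ ϑ).map J'`**, `J' = J ∘ (UnrCoeff.of ℚ_[2])⁻¹` the direct lift on
the discrete copy of `𝐃` — the whole distribution `D_{θ(h₀∘ϑ)}` is the distribution of the `𝐃`-series `h₀ ∘ ϑ`
read through `J`. [cite: deShalit1987, I.3.3 (8) (p. 17)] [cite: FontaineOuyang2022, §3.1] -/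
theorem map_theta_eq_map_toPadicComplex :
    haveI := Padic.isNonarchimedeanLocalField_holds 2
    ∀ {π : 𝒪[ℚ_[2]]} (hπ : (valuation ℚ_[2]).IsUniformizer (π : ℚ_[2]))
      {σ₀ : absoluteGaloisGroup ℚ_[2]} (hσ₀ : IsAbsArithFrob σ₀) (u : 𝒪[ℚ_[2]]ˣ)
      {ε : (maxUnramifiedCompletion ℚ_[2])ˣ}
      (hε : maxUnramifiedCompletion.galAut ℚ_[2] σ₀ (ε : maxUnramifiedCompletion ℚ_[2]) =
        algebraMap 𝒪[ℚ_[2]] (maxUnramifiedCompletion ℚ_[2]) (u : 𝒪[ℚ_[2]]) * (ε : maxUnramifiedCompletion ℚ_[2]))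
      (h₀ : PowerSeries (LTCoeff ℚ_[2])),
      (PowerSeries.subst ((compSeriesC hπ hσ₀ u hε).map (algebraMap (UnrCoeff ℚ_[2]) (CBall ℚ_[2])))
          (h₀.map ((algebraMap (UnrCoeff ℚ_[2]) (CBall ℚ_[2])).comp
            ((intToUnrCoeff ℚ_[2]).comp (LTCoeff.of ℚ_[2]).symm.toRingHom)))).map
          ((CompletedAlgClosure.equivPadicComplex 2).toRingHom.comp (CBall ℚ_[2]).subtype) =
        ((h₀.map ((intToUnrCoeff ℚ_[2]).comp (LTCoeff.of ℚ_[2]).symm.toRingHom)).subst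
            (compSeriesC hπ hσ₀ u hε)).map
          ((maxUnramifiedCompletion.toPadicComplex 2).comp (UnrCoeff.of ℚ_[2]).symm.toRingHom) := by
  haveI := Padic.isNonarchimedeanLocalField_holds 2
  intro π hπ σ₀ hσ₀ u ε hε h₀
  rw [subst_map_compSeriesC_eq_map]
  ext m
  simp only [mvPowerSeries_map_eq_map, PowerSeries.coeff_map, RingHom.comp_apply, Subring.subtype_apply,
    algebraMap_unrCoeff_coe, RingEquiv.toRingHom_eq_coe, RingHom.coe_coe, CompletedAlgClosure.equivPadicComplex_toC]

/-- The coefficient bound for the `𝐃`-series read through `J'`. [cite: FontaineOuyang2022, §3.1] -/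
theorem norm_coeff_map_toPadicComplex_unrCoeff_le_one
    (H : haveI := Padic.isNonarchimedeanLocalField_holds 2; PowerSeries (UnrCoeff ℚ_[2])) (m : ℕ) :
    haveI := Padic.isNonarchimedeanLocalField_holds 2
    ‖PowerSeries.coeff m (H.map
      ((maxUnramifiedCompletion.toPadicComplex 2).comp (UnrCoeff.of ℚ_[2]).symm.toRingHom))‖ ≤ 1 := by
  haveI := Padic.isNonarchimedeanLocalField_holds 2
  rw [PowerSeries.coeff_map, RingHom.comp_apply]
  exact norm_toPadicComplex_le_one 2 _

/-- ★★ **`F = ℚ₂`: THE SOCKET WITH ITS RIGHT-HAND SIDE IN `𝐃`-CURRENCY** — for every uniformiser `π' = 2u`, every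
arithmetic Frobenius `σ₀` with Lang unit `ε`, every `h₀ ∈ ℤ₂⟦X⟧` with `𝒮_{f'} h₀ = 0` and every `k`:
`∫ x^{k+1} d(restrictUnits (x⁻¹ · D_{θ(h₀∘ϑ)})) = J (δ_k)`, `δ_k := [S^0] D^k (h₀ ∘ ϑ) ∈ 𝐃`
(left-hand side VERBATIM as in `PadicTwo.integral_restrictUnits_density_unitInv_pow_succ_of_colemanTrace_eq_zero`).
[cite: deShalit1987, I.3.5 (11) (p. 18), I.3.3 (7)–(8) (p. 17)] [cite: FontaineOuyang2022, §3.1] -/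
theorem integral_restrictUnits_density_unitInv_pow_succ_eq_toPadicComplex_of_colemanTrace_eq_zero :
    haveI := Padic.isNonarchimedeanLocalField_holds 2
    ∀ {σ₀ : absoluteGaloisGroup ℚ_[2]} (hσ₀ : IsAbsArithFrob σ₀) (u : 𝒪[ℚ_[2]]ˣ)
      {ε : (maxUnramifiedCompletion ℚ_[2])ˣ}
      (hε : maxUnramifiedCompletion.galAut ℚ_[2] σ₀ (ε : maxUnramifiedCompletion ℚ_[2]) =
        algebraMap 𝒪[ℚ_[2]] (maxUnramifiedCompletion ℚ_[2]) (u : 𝒪[ℚ_[2]]) * (ε : maxUnramifiedCompletion ℚ_[2]))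
      (n : ℕ) (h₀ : PowerSeries (LTCoeff ℚ_[2]))
      (_hS : colemanTrace (isUniformizer_unit_mul (Padic.isUniformizer_natCast 2) u) n h₀ = 0) (k : ℕ),
      (restrictUnits ((invAmice₁ 2
        ((PowerSeries.subst ((compSeriesC (Padic.isUniformizer_natCast 2) hσ₀ u hε).map
            (algebraMap (UnrCoeff ℚ_[2]) (CBall ℚ_[2])))
          (h₀.map ((algebraMap (UnrCoeff ℚ_[2]) (CBall ℚ_[2])).comp
            ((intToUnrCoeff ℚ_[2]).comp (LTCoeff.of ℚ_[2]).symm.toRingHom)))).map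
          ((CompletedAlgClosure.equivPadicComplex 2).toRingHom.comp (CBall ℚ_[2]).subtype))
        (norm_coeff_map_le_one _ norm_equivPadicComplex_coe_cBall_le_one _)).density
        (ProfiniteTower.padicInt_isUniform 2) (unitInv ℂ_[2]) uniformContinuous_unitInv norm_unitInv_le)).integral
        (fun x ↦ padicIntCast ℂ_[2] (x ^ (k + 1))) =
      maxUnramifiedCompletion.toPadicComplex 2 ((UnrCoeff.of ℚ_[2]).symm
        (PowerSeries.constantCoeff (mahlerD^[k]
          ((h₀.map ((intToUnrCoeff ℚ_[2]).comp (LTCoeff.of ℚ_[2]).symm.toRingHom)).subst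
            (compSeriesC (Padic.isUniformizer_natCast 2) hσ₀ u hε))))) := by
  haveI := Padic.isNonarchimedeanLocalField_holds 2
  intro σ₀ hσ₀ u ε hε n h₀ hS k
  rw [integral_restrictUnits_density_unitInv_pow_succ_of_colemanTrace_eq_zero hσ₀ u hε n h₀ hS k,
    constantCoeff_mahlerD_iterate_eq_toPadicComplex]

/-- ★★ **`F = ℚ₂`: THE SOCKET ENTIRELY IN `𝐃`-CURRENCY** — with `H := h₀ ∘ ϑ ∈ 𝐃⟦X⟧` (composition over `𝐃`)
and `J' : 𝐃 → ℂ_[2]` the direct lift: `𝒮_{f'} h₀ = 0 ⟹ ∫ x^{k+1} d(restrictUnits (x⁻¹ · D_{H.map J'})) = J' ([S^0] D^k H)`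
for every `k` — de Shalit's (11) `∫ κ^k dμ = δ_k` for the `𝐃`-valued invariants `δ_k`.
[cite: deShalit1987, I.3.5 (11) (p. 18), I.3.4 (p. 18)] [cite: FontaineOuyang2022, §3.1] -/
theorem integral_restrictUnits_density_pow_succ_map_toPadicComplex_of_colemanTrace_eq_zero :
    haveI := Padic.isNonarchimedeanLocalField_holds 2
    ∀ {σ₀ : absoluteGaloisGroup ℚ_[2]} (hσ₀ : IsAbsArithFrob σ₀) (u : 𝒪[ℚ_[2]]ˣ)
      {ε : (maxUnramifiedCompletion ℚ_[2])ˣ}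
      (hε : maxUnramifiedCompletion.galAut ℚ_[2] σ₀ (ε : maxUnramifiedCompletion ℚ_[2]) =
        algebraMap 𝒪[ℚ_[2]] (maxUnramifiedCompletion ℚ_[2]) (u : 𝒪[ℚ_[2]]) * (ε : maxUnramifiedCompletion ℚ_[2]))
      (n : ℕ) (h₀ : PowerSeries (LTCoeff ℚ_[2]))
      (_hS : colemanTrace (isUniformizer_unit_mul (Padic.isUniformizer_natCast 2) u) n h₀ = 0) (k : ℕ),
      (restrictUnits ((invAmice₁ 2
        (((h₀.map ((intToUnrCoeff ℚ_[2]).comp (LTCoeff.of ℚ_[2]).symm.toRingHom)).subst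
            (compSeriesC (Padic.isUniformizer_natCast 2) hσ₀ u hε)).map
          ((maxUnramifiedCompletion.toPadicComplex 2).comp (UnrCoeff.of ℚ_[2]).symm.toRingHom))
        (norm_coeff_map_toPadicComplex_unrCoeff_le_one _)).density
        (ProfiniteTower.padicInt_isUniform 2) (unitInv ℂ_[2]) uniformContinuous_unitInv norm_unitInv_le)).integral
        (fun x ↦ padicIntCast ℂ_[2] (x ^ (k + 1))) =
      maxUnramifiedCompletion.toPadicComplex 2 ((UnrCoeff.of ℚ_[2]).symm
        (PowerSeries.constantCoeff (mahlerD^[k]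
          ((h₀.map ((intToUnrCoeff ℚ_[2]).comp (LTCoeff.of ℚ_[2]).symm.toRingHom)).subst
            (compSeriesC (Padic.isUniformizer_natCast 2) hσ₀ u hε))))) := by
  haveI := Padic.isNonarchimedeanLocalField_holds 2
  intro σ₀ hσ₀ u ε hε n h₀ hS k
  rw [← integral_restrictUnits_density_unitInv_pow_succ_eq_toPadicComplex_of_colemanTrace_eq_zero hσ₀ u hε n h₀
    hS k, invAmice₁_congr (map_theta_eq_map_toPadicComplex (Padic.isUniformizer_natCast 2) hσ₀ u hε h₀).symm]

end PadicTwo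

end Literature.NumberTheory.EllipticCurves

end
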